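import Mathlib
import Literature.Probability.LatticeModels.TemperleyLiebConnectivityBasis
import HarnessLib

/-!
# The cyclic successor of a non-crossing connectivity and its behaviour under join and isolate

Topic `Literature/Probability/Percolation`. A non-crossing equivalence relation on the sites
`0, …, n-1` (`NCState n`, the connectivity basis of `TemperleyLiebConnectivityBasis`) is the same
as a non-crossing perfect matching of the doubled sites: the block `{p₁ < ⋯ < p_k}` contributes the
arcs `(2p_i+1, 2p_{i+1})` and `(2p₁, 2p_k+1)`, i.e. the out-position `2p+1` of every site `p` is
matched with the in-position `2·nxt(p)` of its **cyclic successor** `nxt p` (the next site of its block,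
cyclically). This file defines `nxt` and its inverse `prd` (**`nxt`**, **`prd`**, **`prd_nxt`**,
**`nxt_prd`**) and proves the two update rules used by the vertex embedding of the connectivity basis:
* **join** of the consecutive sites `b ≁ b+1`: `nxt' = nxt ∘ (b  prd(b+1))` (**`nxt_joinS`**);
* **isolate** the site `b`: `nxt' = nxt ∘ (b  prd b)` (**`nxt_isolS`**),
together with the non-crossing constraints on the relative positions of `b`, `nxt b`, `prd (b+1)`
(**`join_geometry`**) and of `b`, `nxt b`, `prd b` (**`isolate_geometry`**).

## References

* Y. Ikhlef, A. K. Ponsaing, *Finite-size left-passage probability in percolation*, J. Stat. Phys.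
  149 (2012) 10–36, arXiv:1202.5476, §3.1. [IkhlefPonsaing2012]
-/

namespace Literature.Probability.Percolation

open Finset Literature.Probability.LatticeModels.TemperleyLieb

variable {n : ℕ}

/-! ### Cyclic intervals and the cyclic non-crossing property -/

section Cyc

/-- The open cyclic interval from `p` to `j` (all sites other than `p` when `j = p`). [folklore] -/
def cyc (p j k : Fin n) : Prop := if p < j then p < k ∧ k < j else (p < k ∨ k < j)

/-- Membership in a cyclic interval is decidable. [folklore] -/
instance (p j k : Fin n) : Decidable (cyc p j k) := by unfold cyc; infer_instance

/-- The start is not in the interval. [folklore] -/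
theorem not_cyc_left (p j : Fin n) : ¬cyc p j p := by
  unfold cyc; split_ifs with h
  · exact fun h' => lt_irrefl _ h'.1
  · intro h'; rcases h' with h' | h'
    · exact lt_irrefl _ h'
    · exact h h'

/-- The end is not in the interval. [folklore] -/
theorem not_cyc_right (p j : Fin n) : ¬cyc p j j := by
  unfold cyc; split_ifs with h
  · exact fun h' => lt_irrefl _ h'.2
  · intro h'; rcases h' with h' | h'
    · exact h h'
    · exact lt_irrefl _ h'

/-- Two sites other than `p` are comparable in the cyclic order from `p`. [folklore] -/
theorem cyc_total {p j j' : Fin n} (hj : j ≠ p) (hj' : j' ≠ p) (hjj : j ≠ j') : cyc p j' j ∨ cyc p j j' := by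
  unfold cyc
  have h1 := Fin.lt_def (a := p) (b := j); have h2 := Fin.lt_def (a := p) (b := j')
  have h3 := Fin.lt_def (a := j) (b := j'); have h4 := Fin.lt_def (a := j') (b := j)
  have h5 := Fin.lt_def (a := j) (b := p); have h6 := Fin.lt_def (a := j') (b := p)
  have hne1 : j.val ≠ p.val := fun h => hj (Fin.ext h)
  have hne2 : j'.val ≠ p.val := fun h => hj' (Fin.ext h)
  have hne3 : j.val ≠ j'.val := fun h => hjj (Fin.ext h)
  split_ifs <;> omega

variable {r : SiteRel n} (hr : r.IsNCEquiv)
include hr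

/-- Non-crossing, with the conclusion negated. [folklore] -/
theorem nc_cross {i j k l : Fin n} (hij : i < j) (hjk : j < k) (hkl : k < l) (hik : r i k = true) (hjl : r j l = true)
    (h : r i j ≠ true) : False :=
  h (hr.noncross i j k l hij hjk hkl hik hjl)

/-- **The cyclic non-crossing property**: a chord `(x, y)` of another block cannot have `x` inside and
`y` outside the cyclic interval `(p, j)` of a chord `(p, j)`. [folklore] -/
theorem cyc_cross {p j x y : Fin n} (hpj : r p j = true) (hxy : r x y = true) (hpx : r p x ≠ true) (hx : cyc p j x)
    (hy : ¬cyc p j y) (hyp : y ≠ p) (hyj : y ≠ j) : False := by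
  have hxp : x ≠ p := fun h => hpx (by rw [h]; exact hr.refl p)
  have hxj : x ≠ j := fun h => hpx (by rw [h]; exact hpj)
  have S := hr.symm; have T := hr.trans
  unfold cyc at hx hy
  by_cases hc : p < j
  · rw [if_pos hc] at hx hy
    have hy' : y < p ∨ j < y := by
      rcases lt_trichotomy y p with h | h | h
      · exact Or.inl h
      · exact absurd h hyp
      · rcases lt_trichotomy y j with h' | h' | h'
        · exact absurd ⟨h, h'⟩ hy
        · exact absurd h' hyj
        · exact Or.inr h'
    rcases hy' with h | h
    · -- y < p < x < j
      refine nc_cross hr h hx.1 hx.2 (S _ _ hxy) hpj fun h' => hpx ?_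
      exact T _ _ _ (S _ _ h') (S _ _ hxy)
    · -- p < x < j < y
      exact nc_cross hr hx.1 hx.2 h hpj hxy hpx
  · rw [if_neg hc] at hx hy
    push Not at hy
    have hjy : j < y := lt_of_le_of_ne hy.2 (Ne.symm hyj)
    have hyp' : y < p := lt_of_le_of_ne hy.1 hyp
    rcases hx with h | h
    · -- j < y < p < x
      refine nc_cross hr hjy hyp' h (S _ _ hpj) (S _ _ hxy) fun h' => hpx ?_
      exact T _ _ _ (T _ _ _ hpj h') (S _ _ hxy)
    · -- x < j < y < p
      refine nc_cross hr h hjy hyp' hxy (S _ _ hpj) fun h' => hpx ?_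
      exact S _ _ (T _ _ _ h' (S _ _ hpj))

end Cyc

/-! ### The cyclic successor and predecessor -/

section Nxt

variable (s : NCState n)

/-- The related sites above `p`. [folklore] -/
def above (p : Fin n) : Finset (Fin n) := univ.filter fun j => p < j ∧ s.1 p j = true

/-- The related sites below `p`. [folklore] -/
def below (p : Fin n) : Finset (Fin n) := univ.filter fun j => j < p ∧ s.1 p j = true

/-- The block of `p`. [folklore] -/
def ncBlk (p : Fin n) : Finset (Fin n) := univ.filter fun j => s.1 p j = true

/-- `p` is in its block. [folklore] -/
theorem mem_ncBlk_self (p : Fin n) : p ∈ ncBlk s p := by simp [ncBlk, s.2.refl p]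

/-- **The cyclic successor** of `p` in its block. [folklore] -/
def nxt (p : Fin n) : Fin n :=
  if h : (above s p).Nonempty then (above s p).min' h else (ncBlk s p).min' ⟨p, mem_ncBlk_self s p⟩

/-- **The cyclic predecessor** of `p` in its block. [folklore] -/
def prd (p : Fin n) : Fin n :=
  if h : (below s p).Nonempty then (below s p).max' h else (ncBlk s p).max' ⟨p, mem_ncBlk_self s p⟩

/-- The successor is related. [folklore] -/
theorem rel_nxt (p : Fin n) : s.1 p (nxt s p) = true := by
  unfold nxt; split_ifs with h
  · have := min'_mem _ h; simp only [above, mem_filter] at this; exact this.2.2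
  · have := min'_mem (ncBlk s p) ⟨p, mem_ncBlk_self s p⟩; simp only [ncBlk, mem_filter] at this; exact this.2

/-- The predecessor is related. [folklore] -/
theorem rel_prd (p : Fin n) : s.1 p (prd s p) = true := by
  unfold prd; split_ifs with h
  · have := max'_mem _ h; simp only [below, mem_filter] at this; exact this.2.2
  · have := max'_mem (ncBlk s p) ⟨p, mem_ncBlk_self s p⟩; simp only [ncBlk, mem_filter] at this; exact this.2

/-- **No related site lies cyclically between `p` and its successor.** [folklore] -/
theorem not_rel_of_cyc_nxt (p k : Fin n) (hk : cyc p (nxt s p) k) : s.1 p k ≠ true := by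
  intro hpk
  unfold nxt at hk
  split_ifs at hk with h
  · -- `nxt = min above`, `p < nxt`
    have hmem : p < (above s p).min' h ∧ s.1 p ((above s p).min' h) = true := (mem_filter.1 (min'_mem _ h)).2
    unfold cyc at hk; rw [if_pos hmem.1] at hk
    have : k ∈ above s p := by simp [above, hk.1, hpk]
    exact absurd (min'_le _ _ this) (not_le.2 hk.2)
  · -- no related site above `p`; `nxt = min ncBlk ≤ p`
    have hle : (ncBlk s p).min' ⟨p, mem_ncBlk_self s p⟩ ≤ p := min'_le _ _ (mem_ncBlk_self s p)
    unfold cyc at hk; rw [if_neg (not_lt.2 hle)] at hk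
    rcases hk with hk | hk
    · exact h ⟨k, by simp [above, hk, hpk]⟩
    · have : k ∈ ncBlk s p := by simp [ncBlk, hpk]
      exact absurd (min'_le _ _ this) (not_le.2 hk)

/-- **No related site lies cyclically between the predecessor of `p` and `p`.** [folklore] -/
theorem not_rel_of_cyc_prd (p k : Fin n) (hk : cyc (prd s p) p k) : s.1 p k ≠ true := by
  intro hpk
  unfold prd at hk
  split_ifs at hk with h
  · have hmem : (below s p).max' h < p ∧ s.1 p ((below s p).max' h) = true := (mem_filter.1 (max'_mem _ h)).2
    unfold cyc at hk; rw [if_pos hmem.1] at hk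
    have : k ∈ below s p := by simp [below, hk.2, hpk]
    exact absurd (le_max' _ _ this) (not_le.2 hk.1)
  · have hle : p ≤ (ncBlk s p).max' ⟨p, mem_ncBlk_self s p⟩ := le_max' _ _ (mem_ncBlk_self s p)
    unfold cyc at hk; rw [if_neg (not_lt.2 hle)] at hk
    rcases hk with hk | hk
    · have : k ∈ ncBlk s p := by simp [ncBlk, hpk]
      exact absurd (le_max' _ _ this) (not_le.2 hk)
    · exact h ⟨k, by simp [below, hk, hpk]⟩

/-- **Uniqueness of the successor**: a related site with no related site cyclically before it. [folklore] -/
theorem nxt_unique {p j : Fin n} (hpj : s.1 p j = true) (hj : ∀ k, cyc p j k → s.1 p k ≠ true) : nxt s p = j := by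
  by_contra hne
  by_cases h1 : nxt s p = p
  · -- the block is `{p}`
    have : s.1 p j ≠ true := by
      refine not_rel_of_cyc_nxt s p j ?_
      rw [h1]; unfold cyc; rw [if_neg (lt_irrefl _)]
      rcases lt_trichotomy p j with h | h | h
      · exact Or.inl h
      · exact (hne (h1.trans h)).elim
      · exact Or.inr h
    exact this hpj
  by_cases h2 : j = p
  · subst h2
    have : s.1 j (nxt s j) ≠ true := by
      refine hj _ ?_
      unfold cyc; rw [if_neg (lt_irrefl _)]
      rcases lt_trichotomy j (nxt s j) with h | h | h
      · exact Or.inl h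
      · exact absurd h.symm h1
      · exact Or.inr h
    exact this (rel_nxt s j)
  rcases cyc_total h2 h1 (Ne.symm hne) with h | h
  · exact not_rel_of_cyc_nxt s p j h hpj
  · exact hj _ h (rel_nxt s p)

/-- **`prd` is a right inverse of `nxt`.** [folklore] -/
theorem nxt_prd (p : Fin n) : nxt s (prd s p) = p := by
  refine nxt_unique s (s.2.symm _ _ (rel_prd s p)) fun k hk h => ?_
  exact not_rel_of_cyc_prd s p k hk (s.2.trans _ _ _ (rel_prd s p) h)

/-- `nxt` is surjective, hence bijective. [folklore] -/
theorem nxt_bijective : Function.Bijective (nxt s) :=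
  (Finite.surjective_iff_bijective).1 fun p => ⟨prd s p, nxt_prd s p⟩

/-- `nxt` is injective. [folklore] -/
theorem nxt_injective : Function.Injective (nxt s) := (nxt_bijective s).1

/-- **`prd` is a left inverse of `nxt`.** [folklore] -/
theorem prd_nxt (p : Fin n) : prd s (nxt s p) = p := nxt_injective s (by rw [nxt_prd])

/-- The successor of a non-singleton site is another site. [folklore] -/
theorem nxt_ne_self_iff (p : Fin n) : nxt s p ≠ p ↔ ∃ j, j ≠ p ∧ s.1 p j = true := by
  constructor
  · exact fun h => ⟨nxt s p, h, rel_nxt s p⟩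
  · rintro ⟨j, hj, hpj⟩ h
    refine not_rel_of_cyc_nxt s p j ?_ hpj
    rw [h]; unfold cyc; rw [if_neg (lt_irrefl _)]
    rcases lt_trichotomy p j with h' | h' | h'
    · exact Or.inl h'
    · exact absurd h'.symm hj
    · exact Or.inr h'

end Nxt

/-! ### Two injections agreeing off one point agree -/

/-- Two injective self-maps of a finite type which agree off one point agree everywhere. [folklore] -/
theorem eq_of_injective_of_eq_off {α : Type*} [Finite α] {f g : α → α} (hf : Function.Injective f) (hg : Function.Injective g)
    (t : α) (h : ∀ p, p ≠ t → f p = g p) : f = g := by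
  funext p
  by_cases hp : p = t
  · subst hp
    have hfs := (Finite.injective_iff_surjective.1 hf)
    obtain ⟨p', hp'⟩ := (Finite.injective_iff_surjective.1 hg) (f p)
    by_cases hpt : p' = p
    · rw [hpt] at hp'; exact hp'.symm
    · have := h p' hpt
      rw [hp'] at this
      exact absurd (hf this) hpt
  · exact h p hp

/-! ### Join of consecutive sites -/

section Join

variable {m : ℕ} (s : NCState (m + 1)) (b : Fin m)

/-- The relation after the join. [folklore] -/
theorem joinS_rel (i j : Fin (m + 1)) :
    (NCState.joinS (Fin.castSucc b) b.succ (by simp) s).1 i j = true ↔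
      s.1 i j = true ∨ (s.1 i (Fin.castSucc b) = true ∧ s.1 b.succ j = true) ∨ (s.1 i b.succ = true ∧ s.1 (Fin.castSucc b) j = true) := by
  rw [NCState.joinS_val, SiteRel.join_eq_true_iff]

variable (hb : s.1 (Fin.castSucc b) b.succ ≠ true)
include hb

omit hb in
/-- **The successor of `b` after joining `b ≁ b+1` is `b+1`.** [folklore] -/
theorem nxt_joinS_left : nxt (NCState.joinS (Fin.castSucc b) b.succ (by simp) s) (Fin.castSucc b) = b.succ := by
  refine nxt_unique _ ((joinS_rel s b _ _).2 (Or.inr (Or.inl ⟨s.2.refl _, s.2.refl _⟩))) fun k hk _ => ?_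
  exfalso
  unfold cyc at hk; rw [if_pos (Fin.castSucc_lt_succ (i := b))] at hk
  have h1 := Fin.lt_def.1 hk.1; have h2 := Fin.lt_def.1 hk.2
  simp at h1 h2; omega

/-- **The successor of the other sites is unchanged** (other than `b` and the predecessor of `b+1`). [folklore] -/
theorem nxt_joinS_of_ne {p : Fin (m + 1)} (hpb : p ≠ Fin.castSucc b) (hpt : p ≠ prd s b.succ) :
    nxt (NCState.joinS (Fin.castSucc b) b.succ (by simp) s) p = nxt s p := by
  have S := s.2.symm; have T := s.2.trans
  have hpj : s.1 p (nxt s p) = true := rel_nxt s p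
  refine nxt_unique _ ((joinS_rel s b _ _).2 (Or.inl hpj)) fun k hk hk' => ?_
  rcases (joinS_rel s b _ _).1 hk' with h | ⟨h1, h2⟩ | ⟨h1, h2⟩
  · exact not_rel_of_cyc_nxt s p k hk h
  · -- `p ~ b`, `b+1 ~ k`: the chord `(k, b+1)` against `(p, nxt p)`
    have hpk : s.1 p k ≠ true := fun h => hb (T _ _ _ (S _ _ h1) (T _ _ _ h (S _ _ h2)))
    have hbn : ¬cyc p (nxt s p) (Fin.castSucc b) := fun h' => not_rel_of_cyc_nxt s p _ h' h1
    refine cyc_cross s.2 hpj (S _ _ h2) hpk hk ?_ ?_ ?_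
    · intro hc
      have hpb' : p.val ≠ b.val := fun h => hpb (Fin.ext (by simp [h]))
      simp only [cyc, Fin.lt_def, Fin.val_castSucc, Fin.val_succ] at hc hbn
      split_ifs at hc hbn <;> omega
    · intro h; rw [← h] at h1; exact hb (S _ _ h1)
    · intro h; rw [← h] at hpj; exact hb (T _ _ _ (S _ _ h1) hpj)
  · -- `p ~ b+1`, `b ~ k`: the chord `(k, b)` against `(p, nxt p)`
    have hpk : s.1 p k ≠ true := fun h => hb (S _ _ (T _ _ _ (S _ _ h1) (T _ _ _ h (S _ _ h2))))
    have hbn : ¬cyc p (nxt s p) b.succ := fun h' => not_rel_of_cyc_nxt s p _ h' h1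
    have hjR : nxt s p ≠ b.succ := fun h => hpt (by rw [← h, prd_nxt])
    refine cyc_cross s.2 hpj (S _ _ h2) hpk hk ?_ ?_ ?_
    · intro hc
      have hjR' : (nxt s p).val ≠ b.val + 1 := fun h => hjR (Fin.ext (by simp [h]))
      simp only [cyc, Fin.lt_def, Fin.val_castSucc, Fin.val_succ] at hc hbn
      split_ifs at hc hbn <;> omega
    · intro h; rw [← h] at h1; exact hb h1
    · intro h; rw [← h] at hpj; exact hb (T _ _ _ (S _ _ hpj) h1)

/-- **The join rule**: `nxt' = nxt ∘ (b  prd (b+1))`. [folklore] -/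
theorem nxt_joinS : nxt (NCState.joinS (Fin.castSucc b) b.succ (by simp) s) = nxt s ∘ Equiv.swap (Fin.castSucc b) (prd s b.succ) := by
  refine eq_of_injective_of_eq_off (nxt_injective _) ((nxt_injective s).comp (Equiv.injective _)) (prd s b.succ) fun p hp => ?_
  by_cases hpb : p = Fin.castSucc b
  · rw [hpb, nxt_joinS_left s b, Function.comp_apply, Equiv.swap_apply_left, nxt_prd]
  · rw [nxt_joinS_of_ne s b hb hpb hp, Function.comp_apply, Equiv.swap_apply_of_ne_of_ne hpb hp]

/-- **The geometry of a join**: with `nb = nxt b` and `t = prd (b+1)`: not both `b < nb` and `t < b+1`,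
and `t < nb ↔ (b < nb xor t < b+1)`. [folklore] -/
theorem join_geometry :
    ¬(Fin.castSucc b < nxt s (Fin.castSucc b) ∧ prd s b.succ < b.succ) ∧
      (prd s b.succ < nxt s (Fin.castSucc b) ↔ Xor (Fin.castSucc b < nxt s (Fin.castSucc b)) (prd s b.succ < b.succ)) := by
  have S := s.2.symm; have T := s.2.trans
  set nb := nxt s (Fin.castSucc b) with hnb
  set t := prd s b.succ with ht
  have hbn : s.1 (Fin.castSucc b) nb = true := rel_nxt s _
  have htR : s.1 t b.succ = true := S _ _ (rel_prd s _)
  have hnt : s.1 t (Fin.castSucc b) ≠ true := fun h => hb (T _ _ _ (S _ _ h) htR)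
  have hnR : s.1 nb b.succ ≠ true := fun h => hb (T _ _ _ hbn h)
  have hne1 : nb.val ≠ b.val + 1 := fun h => hnR (by rw [show nb = b.succ from Fin.ext (by simp [h])]; exact s.2.refl _)
  have hne2 : t.val ≠ b.val := fun h => hnt (by rw [show t = Fin.castSucc b from Fin.ext (by simp [h])]; exact s.2.refl _)
  have hne3 : t ≠ nb := fun h => hnt (by rw [h]; exact S _ _ hbn)
  have hne3' : t.val ≠ nb.val := fun h => hne3 (Fin.ext h)
  have hv := b.isLt
  -- the crossing configurations
  have F1 : Fin.castSucc b < nb → prd s b.succ < b.succ → False := fun hf1 hf2 => by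
    -- `t < b < b+1 < nb`
    have h1 : t < Fin.castSucc b := by rw [Fin.lt_def] at hf2 ⊢; simp at hf2 ⊢; omega
    have h2 : b.succ < nb := by rw [Fin.lt_def] at hf1 ⊢; simp at hf1 ⊢; omega
    exact nc_cross s.2 h1 (Fin.castSucc_lt_succ (i := b)) h2 htR hbn hnt
  have F2 : Fin.castSucc b < nb → ¬prd s b.succ < b.succ → t < nb := fun hf1 hf2 => by
    by_contra hf3
    -- `b < b+1 < nb < t`
    have h2 : b.succ < nb := by rw [Fin.lt_def] at hf1 ⊢; simp at hf1 ⊢; omega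
    have h3 : nb < t := by rw [Fin.lt_def] at hf3 ⊢; omega
    exact nc_cross s.2 (Fin.castSucc_lt_succ (i := b)) h2 h3 hbn (S _ _ htR) hb
  have F3 : ¬Fin.castSucc b < nb → prd s b.succ < b.succ → t < nb := fun hf1 hf2 => by
    by_contra hf3
    by_cases hnbb : nb = Fin.castSucc b
    · rw [hnbb, Fin.lt_def] at hf3; rw [Fin.lt_def] at hf2; simp at hf2 hf3; omega
    · -- `nb < t < b < b+1`
      have h1 : nb < t := lt_of_le_of_ne (not_lt.1 hf3) (Ne.symm hne3)
      have h2 : t < Fin.castSucc b := by rw [Fin.lt_def] at hf2 ⊢; simp at hf2 ⊢; omega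
      exact nc_cross s.2 h1 h2 (Fin.castSucc_lt_succ (i := b)) (S _ _ hbn) htR (fun h => hnt (S _ _ (T _ _ _ hbn h)))
  have F4 : ¬Fin.castSucc b < nb → ¬prd s b.succ < b.succ → ¬t < nb := fun hf1 hf2 hf3 => by
    rw [Fin.lt_def] at hf1 hf2 hf3; simp at hf1 hf2; omega
  refine ⟨fun h => F1 h.1 h.2, ⟨fun h3 => ?_, ?_⟩⟩
  · by_cases h1 : Fin.castSucc b < nb
    · by_cases h2 : prd s b.succ < b.succ
      · exact (F1 h1 h2).elim
      · exact Or.inl ⟨h1, h2⟩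
    · by_cases h2 : prd s b.succ < b.succ
      · exact Or.inr ⟨h2, h1⟩
      · exact (F4 h1 h2 h3).elim
  · rintro (⟨h1, h2⟩ | ⟨h2, h1⟩)
    · exact F2 h1 h2
    · exact F3 h1 h2

end Join

/-! ### Isolating a site -/

section Isolate

variable (s : NCState n) (b : Fin n)

/-- The relation after isolating `b`. [folklore] -/
theorem isolS_rel (i j : Fin n) : (NCState.isolS b s).1 i j = true ↔ i = j ∨ (i ≠ b ∧ j ≠ b ∧ s.1 i j = true) := by
  rw [NCState.isolS_val, SiteRel.isolate_eq_true_iff]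

/-- **The isolated site is its own successor.** [folklore] -/
theorem nxt_isolS_self : nxt (NCState.isolS b s) b = b := by
  refine nxt_unique _ ((isolS_rel s b _ _).2 (Or.inl rfl)) fun k hk hk' => ?_
  rcases (isolS_rel s b _ _).1 hk' with h | ⟨h, -, -⟩
  · rw [← h] at hk; exact not_cyc_left _ _ hk
  · exact h rfl

/-- **The successor of the other sites is unchanged** (other than `b` and its predecessor). [folklore] -/
theorem nxt_isolS_of_ne {p : Fin n} (hpb : p ≠ b) (hpt : p ≠ prd s b) : nxt (NCState.isolS b s) p = nxt s p := by
  have hjb : nxt s p ≠ b := fun h => hpt (by rw [← h, prd_nxt])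
  refine nxt_unique _ ((isolS_rel s b _ _).2 ?_) fun k hk hk' => ?_
  · by_cases h : p = nxt s p
    · exact Or.inl h
    · exact Or.inr ⟨hpb, hjb, rel_nxt s p⟩
  · rcases (isolS_rel s b _ _).1 hk' with h | ⟨-, -, h⟩
    · rw [← h] at hk; exact not_cyc_left _ _ hk
    · exact not_rel_of_cyc_nxt s p k hk h

/-- **The isolate rule**: `nxt' = nxt ∘ (b  prd b)`. [folklore] -/
theorem nxt_isolS : nxt (NCState.isolS b s) = nxt s ∘ Equiv.swap b (prd s b) := by
  refine eq_of_injective_of_eq_off (nxt_injective _) ((nxt_injective s).comp (Equiv.injective _)) (prd s b) fun p hp => ?_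
  by_cases hpb : p = b
  · rw [hpb, nxt_isolS_self, Function.comp_apply, Equiv.swap_apply_left, nxt_prd]
  · rw [nxt_isolS_of_ne s b hpb hp, Function.comp_apply, Equiv.swap_apply_of_ne_of_ne hpb hp]

/-- **The geometry of an isolation** (non-singleton `b` with `prd b ≠ nxt b`): `b < nxt b` or `prd b < b`,
and `prd b < nxt b ↔ (b < nxt b ∧ prd b < b)`. [folklore] -/
theorem isolate_geometry (hnb : nxt s b ≠ b) :
    (b < nxt s b ∨ prd s b < b) ∧ (prd s b < nxt s b ↔ b < nxt s b ∧ prd s b < b) := by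
  have hpb : prd s b ≠ b := fun h => hnb (by
    have := nxt_prd s b; rw [h] at this; exact this)
  have hrel : s.1 b (prd s b) = true := rel_prd s b
  -- `prd b` is not inside `cyc(b, nxt b)`
  have hnot : ¬cyc b (nxt s b) (prd s b) := fun h => not_rel_of_cyc_nxt s b _ h hrel
  have e1 := Fin.lt_def (a := b) (b := nxt s b); have e2 := Fin.lt_def (a := prd s b) (b := b)
  have e3 := Fin.lt_def (a := prd s b) (b := nxt s b)
  have hne1 : (nxt s b).val ≠ b.val := fun h => hnb (Fin.ext h)
  have hne2 : (prd s b).val ≠ b.val := fun h => hpb (Fin.ext h)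
  simp only [cyc, Fin.lt_def] at hnot
  split_ifs at hnot with hc <;> omega

end Isolate

end Literature.Probability.Percolation
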